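import Mathlib
import HarnessLib

/-!
# Kill test `SurfaceTermination` (stmt-ResolutionOfSingularities-16488), THEOREM 23-S∞ step (S3) —
# the ADJUGATE IDENTITY «`Ann(coker Φ) = (det Φ : I_{r−1}(Φ))`» for a square matrix with regular determinant

Route `ResolutionOfSingularities/HomologicalConductor`, crux chain W4.4 (lead g24; CRUX-PLAN v10.10 (E) Lean target (e3),
KERNEL-g24 §1.3 (iii-c)).  `[OURS]` — AI-formalised, weaker than expert review; NOT a statement of the manuscript under review
(Hironaka 2017); pure matrix algebra over a commutative ring, no resolution / cohomology-annihilator infrastructure.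

For a square matrix `A` over a commutative ring `R`, an element `s` annihilates the cokernel `Rⁿ / A·Rⁿ` iff `A·B = s·1`
for some matrix `B` (`forall_smul_mem_range_iff_exists_mul_eq`); then `det A · B = s · adj A`, so `det A ∣ s · (adj A)ᵢⱼ`
for all `i, j` (`det_dvd_mul_adjugate_of_mul_eq`, unconditional); conversely, when `det A` is a non-zero-divisor, these
divisibilities give back `A·B = s·1` (`exists_mul_eq_of_det_dvd`).  Hence
`Ann_R(coker A) = ((det A) : {adjugate entries}) = ((det A) : I_{n−1}(A))`
(`mem_annihilator_coker_iff_det_dvd`, `annihilator_coker_eq_colon`, and the `(n−1)`-minor form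
`mem_annihilator_coker_iff_det_dvd_minor` via `Matrix.adjugate_fin_succ_eq_det_submatrix`).
Use in the cell: with `Φ : ℳ′ → ℳ^∨` the comparison map of the full sheaves of a reflexive module `M` over a rational surface
singularity, `𝒜_M := Ann(ℳ^∨/ℳ′) = (det Φ : I_{r−1}(Φ)) = 𝒪(−A_M)` is invertible and `𝔰(M) = Γ(𝒜_M) = I_{A_M⁺}` (THEOREM 23-S∞,
desk DN138–DN142, attacked KERNEL-g24 §1).
-/

-- single-problem summit: the doubled namespace component is forced
set_option linter.dupNamespace false

namespace Summit.ResolutionOfSingularities.ResolutionOfSingularities.Theorems.SurfaceTermination.AnnCoker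

open Matrix

variable {R : Type*} [CommRing R] {n : Type*} [Fintype n]

section Adjugate

variable [DecidableEq n]

/-- `s` multiplies every vector of `Rⁿ` into the column space of the square matrix `A` iff `A * B = s • 1` for some
matrix `B` (take for the columns of `B` preimages of the `s • e_j`). [folklore] -/
theorem forall_smul_mem_range_iff_exists_mul_eq (A : Matrix n n R) (s : R) :
    (∀ v : n → R, s • v ∈ LinearMap.range A.mulVecLin) ↔
      ∃ B : Matrix n n R, A * B = s • (1 : Matrix n n R) := by
  constructor
  · intro h
    have hj : ∀ j : n, ∃ b : n → R, A *ᵥ b = s • (Pi.single j 1 : n → R) := fun j => by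
      obtain ⟨b, hb⟩ := h (Pi.single j 1)
      exact ⟨b, by simpa using hb⟩
    choose b hb using hj
    refine ⟨Matrix.of fun i j => b j i, ?_⟩
    ext i j
    have hbj := congrFun (hb j) i
    simp only [Matrix.mulVec, dotProduct, Pi.smul_apply, Pi.single_apply, smul_eq_mul] at hbj
    simp only [Matrix.mul_apply, Matrix.of_apply, Matrix.smul_apply, Matrix.one_apply, smul_eq_mul]
    rw [hbj]
  · rintro ⟨B, hB⟩ v
    refine ⟨B *ᵥ v, ?_⟩
    simp only [Matrix.mulVecLin_apply, Matrix.mulVec_mulVec, hB, Matrix.smul_mulVec, Matrix.one_mulVec]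

/-- If `A * B = s • 1` then `det A • B = s • adj A` (multiply by the adjugate on the left). [folklore] -/
theorem det_smul_eq_smul_adjugate_of_mul_eq {A B : Matrix n n R} {s : R} (h : A * B = s • (1 : Matrix n n R)) :
    A.det • B = s • A.adjugate := by
  have h' : A.adjugate * (A * B) = A.adjugate * (s • (1 : Matrix n n R)) := by rw [h]
  rwa [← Matrix.mul_assoc, Matrix.adjugate_mul, Matrix.smul_mul, Matrix.one_mul, Matrix.mul_smul,
    Matrix.mul_one] at h'

/-- If `A * B = s • 1` then `det A` divides `s · (adj A)ᵢⱼ` for all `i, j` — the direction of the adjugate identity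
that needs no hypothesis on `det A`. [folklore] -/
theorem det_dvd_mul_adjugate_of_mul_eq {A B : Matrix n n R} {s : R} (h : A * B = s • (1 : Matrix n n R))
    (i j : n) : A.det ∣ s * A.adjugate i j := by
  refine ⟨B i j, ?_⟩
  have hij := congrFun (congrFun (det_smul_eq_smul_adjugate_of_mul_eq h) i) j
  simp only [Matrix.smul_apply, smul_eq_mul] at hij
  exact hij.symm

/-- Conversely, if `det A` is a non-zero-divisor and `det A ∣ s · (adj A)ᵢⱼ` for all `i, j`, then `A * B = s • 1` for the
matrix `B` of quotients: `det A • (A * B) = A * (s • adj A) = det A • (s • 1)`, and `det A` cancels. [folklore] -/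
theorem exists_mul_eq_of_det_dvd {A : Matrix n n R} (hdet : A.det ∈ nonZeroDivisors R) {s : R}
    (h : ∀ i j, A.det ∣ s * A.adjugate i j) : ∃ B : Matrix n n R, A * B = s • (1 : Matrix n n R) := by
  choose B hB using h
  refine ⟨Matrix.of B, ?_⟩
  have hsB : A.det • (Matrix.of B : Matrix n n R) = s • A.adjugate := by
    ext i j
    simp only [Matrix.smul_apply, Matrix.of_apply, smul_eq_mul]
    exact (hB i j).symm
  have key : A.det • (A * Matrix.of B) = A.det • (s • (1 : Matrix n n R)) := by
    calc A.det • (A * Matrix.of B) = A * (A.det • Matrix.of B) := (Matrix.mul_smul _ _ _).symm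
      _ = A * (s • A.adjugate) := by rw [hsB]
      _ = s • (A * A.adjugate) := Matrix.mul_smul _ _ _
      _ = s • (A.det • (1 : Matrix n n R)) := by rw [Matrix.mul_adjugate]
      _ = A.det • (s • (1 : Matrix n n R)) := smul_comm _ _ _
  ext i j
  have hij := congrFun (congrFun key i) j
  simp only [Matrix.smul_apply, smul_eq_mul] at hij
  exact (mul_cancel_left_mem_nonZeroDivisors hdet).mp hij

end Adjugate

/-- `s` annihilates the cokernel `Rⁿ ⧸ range A` iff `s` multiplies every vector into the range. [folklore] -/
theorem mem_annihilator_coker_iff_forall_smul_mem (A : Matrix n n R) (s : R) :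
    s ∈ Module.annihilator R ((n → R) ⧸ LinearMap.range A.mulVecLin) ↔
      ∀ v : n → R, s • v ∈ LinearMap.range A.mulVecLin := by
  rw [Module.mem_annihilator]
  constructor
  · intro h v
    have hv := h (Submodule.Quotient.mk v)
    rwa [← Submodule.Quotient.mk_smul, Submodule.Quotient.mk_eq_zero] at hv
  · intro h q
    obtain ⟨v, rfl⟩ := Submodule.Quotient.mk_surjective _ q
    rw [← Submodule.Quotient.mk_smul, Submodule.Quotient.mk_eq_zero]
    exact h v

variable [DecidableEq n]

/-- **The adjugate identity (THEOREM 23-S∞ step (S3)).** For a square matrix `A` over a commutative ring with `det A` a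
non-zero-divisor, `s ∈ Ann_R(Rⁿ ⧸ A·Rⁿ)` iff `det A ∣ s · (adj A)ᵢⱼ` for all `i, j`, i.e.
`Ann(coker A) = ((det A) : I_{n−1}(A))`. [this work; folklore (Buchsbaum–Eisenbud-type colon description of the annihilator
of a cokernel)] -/
theorem mem_annihilator_coker_iff_det_dvd (A : Matrix n n R) (hdet : A.det ∈ nonZeroDivisors R) (s : R) :
    s ∈ Module.annihilator R ((n → R) ⧸ LinearMap.range A.mulVecLin) ↔
      ∀ i j, A.det ∣ s * A.adjugate i j := by
  rw [mem_annihilator_coker_iff_forall_smul_mem, forall_smul_mem_range_iff_exists_mul_eq]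
  exact ⟨fun ⟨B, hB⟩ i j => det_dvd_mul_adjugate_of_mul_eq hB i j, exists_mul_eq_of_det_dvd hdet⟩

/-- The unconditional half: `Ann(coker A) ⊆ ((det A) : {adjugate entries})` for EVERY square matrix. [folklore] -/
theorem det_dvd_mul_adjugate_of_mem_annihilator (A : Matrix n n R) {s : R}
    (hs : s ∈ Module.annihilator R ((n → R) ⧸ LinearMap.range A.mulVecLin)) (i j : n) :
    A.det ∣ s * A.adjugate i j := by
  obtain ⟨B, hB⟩ := (forall_smul_mem_range_iff_exists_mul_eq A s).mp
    ((mem_annihilator_coker_iff_forall_smul_mem A s).mp hs)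
  exact det_dvd_mul_adjugate_of_mul_eq hB i j

/-- **Ideal form:** `Ann_R(Rⁿ ⧸ A·Rⁿ) = ((det A) : I)` where `I` is generated by the entries of the adjugate (= the
`(n−1) × (n−1)` minors up to sign), for `det A` a non-zero-divisor. [this work] -/
theorem annihilator_coker_eq_colon (A : Matrix n n R) (hdet : A.det ∈ nonZeroDivisors R) :
    Module.annihilator R ((n → R) ⧸ LinearMap.range A.mulVecLin) =
      (Ideal.span {A.det}).colon (Set.range fun p : n × n => A.adjugate p.1 p.2) := by
  ext s
  rw [mem_annihilator_coker_iff_det_dvd A hdet, Submodule.mem_colon]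
  simp only [Set.forall_mem_range, Prod.forall, smul_eq_mul, Ideal.mem_span_singleton]

/-- **Minor form** (`Fin (m+1)`-indexed matrices): `s ∈ Ann(coker A)` iff `det A ∣ s · det A^{(j,i)}` for all
`(n−1) × (n−1)` minors `A^{(j,i)}` (row `j` and column `i` deleted) — the sign `(−1)^{i+j}` of the cofactor is a unit.
[this work] -/
theorem mem_annihilator_coker_iff_det_dvd_minor {m : ℕ} (A : Matrix (Fin (m + 1)) (Fin (m + 1)) R)
    (hdet : A.det ∈ nonZeroDivisors R) (s : R) :
    s ∈ Module.annihilator R ((Fin (m + 1) → R) ⧸ LinearMap.range A.mulVecLin) ↔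
      ∀ i j : Fin (m + 1), A.det ∣ s * (A.submatrix j.succAbove i.succAbove).det := by
  rw [mem_annihilator_coker_iff_det_dvd A hdet]
  refine forall_congr' fun i => forall_congr' fun j => ?_
  rw [Matrix.adjugate_fin_succ_eq_det_submatrix, ← mul_assoc, mul_comm s ((-1 : R) ^ (j + i : ℕ)), mul_assoc]
  exact ((isUnit_one.neg).pow _).dvd_mul_left

end Summit.ResolutionOfSingularities.ResolutionOfSingularities.Theorems.SurfaceTermination.AnnCoker
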